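import Summits.Ventures.HSemireg.WedgeHankelRecurrenceGaussGeronimus

/-!
# Venture HSemireg — **DISCRETE ORTHOGONALITY ON THE GAUSS NODES AND THE WEIGHTS IN CLOSED FORM**: if `(λ, z)` (`z_0 < ⋯ < z_t`) is the Gauss rule of a positive discrete measure whose orthogonal
# polynomials obey `q_{k+2} = (X − a_{k+1}) q_{k+1} − b_{k+1} q_k`, then (i) `Σ_k λ_k q_i(z_k) q_j(z_k) = δ_{ij} h_j` (`i, j ≤ t`), (ii) the DUAL relation `Σ_{j≤t} q_j(z_k) q_j(z_l) ∕ h_j = δ_{kl} ∕ λ_k`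
# (Christoffel–Darboux), and (iii) the classical weight formulas `λ_k q_{t+1}′(z_k) q_t(z_k) = h_t` and `λ_k q_{t+1}′(z_k) q_{t+2}(z_k) = −h_{t+1}`

HONEST FRAMING. Part of the Lean index of the computation cell `pub-hsemireg` (seat p10 gen 43, Sunday typer «UNIFORM-IN-n»).  Real polynomials and finite sums only; no variety, no cohomology
theory, no sheaf, no Ext group and no semiregularity map is constructed here; nothing here says that HC / HC_CM / HC_AV holds; no Literature fact (unproved `Prop`) is declared or used.  Custodian
versions as in `WedgeHankelSiegelIdeal` (1/3).
SOURCES (cited).  G. Szegő, *Orthogonal Polynomials*, Thm 3.4.2 and (3.4.7)–(3.4.8) (the Christoffel numbers `λ_ν = k_{n+1} ∕ (k_n p_{n+1}′(x_ν) p_n(x_ν)) = −k_n ∕ (k_{n+1} p_{n+1}′(x_ν) p_{n−1}(x_ν))` in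
the orthonormal normalisation); T. S. Chihara, *An Introduction to Orthogonal Polynomials* (1978), Ch. I Thm 6.2 and (6.5), Ex. 6.4 (dual orthogonality); G. H. Golub, J. H. Welsch, Math. Comp. 23
(1969) §2; W. Gautschi, *Orthogonal Polynomials: Computation and Approximation* (2004), Thm 1.31.
PROOF TYPED HERE.  (i) exactness in degree `2t + 1` plus orthogonality; (ii) N299 `christoffel_darboux_kernel` with both arguments at nodes (`q_{t+1}` vanishes there, N290 `nodePoly_eq_of_exact`) and
N277 `gauss_weight_mul_kernel_diag_eq_one` for the diagonal; (iii) N299 `christoffel_darboux_kernel_diag` at a node and `λ_k K_t(z_k, z_k) = 1`; the second form by the recurrence at the node,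
`q_{t+2}(z_k) = −b_{t+1} q_t(z_k)`, and N299 `sum_sq_succ_eq_b_mul_sum_sq`.
DEDUP DISCLOSURE (`rg -n 'gauss_orthogonality_on_nodes|kernel_offdiag|gauss_weight_mul_deriv' Summits/Ventures/HSemireg`, 2026-09-03): N280 `recurrence_dual_orthogonality` ∕ `favard_finite` are the
FAVARD-measure case with `b`-products; N281 `favard_weight_eq_secondKind_div_derivative` likewise; here a general positive discrete measure and its `h_j`.  The 5 names below: 0 hits tree-wide.

WHAT IS IN THE TREE.  N239 `sum_mul_eval_eq_of_moments_eq`; N273 `sum_mul_eval_sq_pos_of_natDegree_lt`; N274 `recurrence_christoffel_darboux_confluent_pos`; N277 `gauss_weight_mul_kernel_diag_eq_one`; N279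
`recurrence_monic_natDegree`; N290 `nodePoly_eq_of_exact`; N299 `christoffel_darboux_kernel`, `christoffel_darboux_kernel_diag`, `sum_sq_succ_eq_b_mul_sum_sq`.
THIS FILE (namespace `Summit.Ventures.HSemireg.Wedge.HankelOuter` continued; CHAINED on N307 (import), N239, N277, N290, N299; 0 definitions):
* §1073 **`gauss_orthogonality_on_nodes`** (`Σ_k λ_k q_i(z_k) q_j(z_k) = δ_{ij} h_j`, `i, j ≤ t`), **`gauss_kernel_offdiag_eq_zero`** (`Σ_{j≤t} q_j(z_k) q_j(z_l) ∕ h_j = 0`, `k ≠ l`),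
  `gauss_kernel_on_nodes` (the dual relation with `δ_{kl} ∕ λ_k`), **`gauss_weight_mul_deriv_mul_eq_norm`** (`λ_k q_{t+1}′(z_k) q_t(z_k) = h_t`), **`gauss_weight_mul_deriv_mul_succ_eq_neg_norm`**
  (`λ_k q_{t+1}′(z_k) q_{t+2}(z_k) = −h_{t+1}`).
CAVEATS.  Positive discrete measures; the recurrence is assumed to extend the orthogonal system up to `t + 2` (N295 `exists_positive_recurrence_of_orthogonal`).  Nothing Ext-side.  New names only.
-/

open Module Polynomial
open scoped Matrix Polynomial

namespace Summit.Ventures.HSemireg.Wedge.HankelOuter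

/-! ## §1073. Discrete orthogonality on the Gauss nodes; the weights in closed form -/

/-- **`Σ_k λ_k q_i(z_k) q_j(z_k) = δ_{ij} h_j`** for `i, j ≤ t` and any rule `(λ, z)` exact in degree `≤ 2t` for `(ν, w)` (the `q_k` monic of degree `k`, orthogonal to lower degrees).
[Chihara I (6.5); Szegő Thm 3.4.2; this file, §1073] -/
theorem gauss_orthogonality_on_nodes {N t : ℕ} {ν w : Fin N → ℝ} {q : ℕ → ℝ[X]} (hdeg : ∀ k, k ≤ t → (q k).natDegree = k)
    (horth : ∀ k, k ≤ t → ∀ G : ℝ[X], G.natDegree < k → ∑ l, ν l * (q k * G).eval (w l) = 0) {μ z : Fin (t + 1) → ℝ}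
    (hmom : ∀ p, p ≤ 2 * t → ∑ k, μ k * z k ^ p = ∑ l, ν l * w l ^ p) {i j : ℕ} (hi : i ≤ t) (hj : j ≤ t) :
    ∑ k, μ k * ((q i).eval (z k) * (q j).eval (z k)) = if i = j then ∑ l, ν l * ((q j).eval (w l)) ^ 2 else 0 := by
  have hmom' : ∀ p, p < 2 * t + 1 → ∑ k, μ k * z k ^ p = ∑ l, ν l * w l ^ p := fun p hp => hmom p (by omega)
  have hdeg2 : (q i * q j).natDegree < 2 * t + 1 := lt_of_le_of_lt natDegree_mul_le (by rw [hdeg i hi, hdeg j hj]; omega)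
  have h := sum_mul_eval_eq_of_moments_eq hmom' hdeg2
  simp only [eval_mul] at h
  rw [h]
  split_ifs with hij
  · rw [hij]; exact Finset.sum_congr rfl fun l _ => by rw [sq]
  · rcases lt_or_gt_of_ne hij with hlt | hgt
    · have := horth j hj (q i) (by rw [hdeg i hi]; exact hlt)
      rw [← this]; exact Finset.sum_congr rfl fun l _ => by rw [eval_mul, mul_comm ((q i).eval _)]
    · have := horth i hi (q j) (by rw [hdeg j hj]; exact hgt)
      rw [← this]; exact Finset.sum_congr rfl fun l _ => by rw [eval_mul]

/-- **Dual orthogonality off the diagonal**: for the Gauss rule `(λ, z)` (exact in degree `≤ 2t + 1`) of a positive discrete measure whose orthogonal polynomials obey the recurrence up to `t + 1`,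
`Σ_{j≤t} q_j(z_k) q_j(z_l) ∕ h_j = 0` for `k ≠ l`. [Chihara I Ex. 6.4; Golub–Welsch §2; this file, §1073] -/
theorem gauss_kernel_offdiag_eq_zero {N t : ℕ} {ν w : Fin N → ℝ} (hν : ∀ l, 0 < ν l) (hw : Function.Injective w) (htN : t + 1 < N) {q : ℕ → ℝ[X]} {a b : ℕ → ℝ}
    (hq0 : q 0 = 1) (hq1 : q 1 = Polynomial.X - C (a 0)) (hrec : ∀ n, q (n + 2) = (Polynomial.X - C (a (n + 1))) * q (n + 1) - C (b (n + 1)) * q n)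
    (horth : ∀ k, k ≤ t + 1 → ∀ G : ℝ[X], G.natDegree < k → ∑ l, ν l * (q k * G).eval (w l) = 0) {μ z : Fin (t + 1) → ℝ} (hz : StrictMono z)
    (hmom : ∀ p, p ≤ 2 * t + 1 → ∑ k, μ k * z k ^ p = ∑ l, ν l * w l ^ p) {k l : Fin (t + 1)} (hkl : k ≠ l) :
    ∑ j ∈ Finset.range (t + 1), (q j).eval (z k) * (q j).eval (z l) / ∑ l', ν l' * ((q j).eval (w l')) ^ 2 = 0 := by
  have hmd := recurrence_monic_natDegree hq0 hq1 hrec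
  have hnode : ∏ j, (Polynomial.X - C (z j)) = q (t + 1) := nodePoly_eq_of_exact hν hw (by omega) hmom (hmd (t + 1)).1 (hmd (t + 1)).2 (horth (t + 1) le_rfl)
  have hroot : ∀ i, (q (t + 1)).eval (z i) = 0 := fun i => by
    rw [← hnode, eval_prod]; exact Finset.prod_eq_zero (Finset.mem_univ i) (by simp)
  have hcd := christoffel_darboux_kernel hν hw htN hq0 hq1 hrec horth (m := t + 1) le_rfl (z k) (z l)
  rw [hroot k, hroot l, zero_mul, mul_zero, sub_zero] at hcd
  have hh : 0 < ∑ l', ν l' * ((q t).eval (w l')) ^ 2 := sum_mul_eval_sq_pos_of_natDegree_lt hν hw (hmd t).1.ne_zero (by rw [(hmd t).2]; omega)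
  have hzz : z k - z l ≠ 0 := sub_ne_zero.2 (hz.injective.ne hkl)
  rcases mul_eq_zero.1 hcd with h | h
  · exact absurd h hh.ne'
  · rcases mul_eq_zero.1 h with h' | h'
    · exact absurd h' hzz
    · exact h'

/-- **Dual orthogonality on the Gauss nodes**: `λ_k · Σ_{j≤t} q_j(z_k) q_j(z_l) ∕ h_j = δ_{kl}`. [Chihara I Ex. 6.4; Golub–Welsch §2; Gautschi Thm 1.31; this file, §1073] -/
theorem gauss_kernel_on_nodes {N t : ℕ} {ν w : Fin N → ℝ} (hν : ∀ l, 0 < ν l) (hw : Function.Injective w) (htN : t + 1 < N) {q : ℕ → ℝ[X]} {a b : ℕ → ℝ}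
    (hq0 : q 0 = 1) (hq1 : q 1 = Polynomial.X - C (a 0)) (hrec : ∀ n, q (n + 2) = (Polynomial.X - C (a (n + 1))) * q (n + 1) - C (b (n + 1)) * q n)
    (horth : ∀ k, k ≤ t + 1 → ∀ G : ℝ[X], G.natDegree < k → ∑ l, ν l * (q k * G).eval (w l) = 0) {μ z : Fin (t + 1) → ℝ} (hz : StrictMono z)
    (hmom : ∀ p, p ≤ 2 * t + 1 → ∑ k, μ k * z k ^ p = ∑ l, ν l * w l ^ p) (k l : Fin (t + 1)) :
    μ k * ∑ j ∈ Finset.range (t + 1), (q j).eval (z k) * (q j).eval (z l) / ∑ l', ν l' * ((q j).eval (w l')) ^ 2 = if k = l then 1 else 0 := by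
  have hmd := recurrence_monic_natDegree hq0 hq1 hrec
  split_ifs with hkl
  · subst hkl
    have hh : ∀ j, j ≤ t → ∑ l', ν l' * ((q j).eval (w l')) ^ 2 ≠ 0 := fun j hj =>
      (sum_mul_eval_sq_pos_of_natDegree_lt hν hw (hmd j).1.ne_zero (by rw [(hmd j).2]; omega)).ne'
    have h := gauss_weight_mul_kernel_diag_eq_one (t := t) (fun j _ => (hmd j).1) (fun j _ => (hmd j).2) (fun j hj => horth j (by omega)) hh hz.injective (fun p hp => hmom p (by omega)) k
    rw [← h]
    congr 1
    exact Finset.sum_congr rfl fun j _ => by rw [sq]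
  · rw [gauss_kernel_offdiag_eq_zero hν hw htN hq0 hq1 hrec horth hz hmom hkl, mul_zero]

/-- **`λ_k · q_{t+1}′(z_k) q_t(z_k) = h_t`**: the Gauss weights from the derivative at the node (Szegő (3.4.7) in the monic normalisation). [Szegő (3.4.7); Chihara I Thm 6.2; this file, §1073] -/
theorem gauss_weight_mul_deriv_mul_eq_norm {N t : ℕ} {ν w : Fin N → ℝ} (hν : ∀ l, 0 < ν l) (hw : Function.Injective w) (htN : t + 1 < N) {q : ℕ → ℝ[X]} {a b : ℕ → ℝ}
    (hq0 : q 0 = 1) (hq1 : q 1 = Polynomial.X - C (a 0)) (hrec : ∀ n, q (n + 2) = (Polynomial.X - C (a (n + 1))) * q (n + 1) - C (b (n + 1)) * q n)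
    (horth : ∀ k, k ≤ t + 1 → ∀ G : ℝ[X], G.natDegree < k → ∑ l, ν l * (q k * G).eval (w l) = 0) {μ z : Fin (t + 1) → ℝ} (hz : StrictMono z)
    (hmom : ∀ p, p ≤ 2 * t + 1 → ∑ k, μ k * z k ^ p = ∑ l, ν l * w l ^ p) (k : Fin (t + 1)) :
    μ k * ((derivative (q (t + 1))).eval (z k) * (q t).eval (z k)) = ∑ l, ν l * ((q t).eval (w l)) ^ 2 := by
  have hmd := recurrence_monic_natDegree hq0 hq1 hrec
  have hnode : ∏ j, (Polynomial.X - C (z j)) = q (t + 1) := nodePoly_eq_of_exact hν hw (by omega) hmom (hmd (t + 1)).1 (hmd (t + 1)).2 (horth (t + 1) le_rfl)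
  have hroot : (q (t + 1)).eval (z k) = 0 := by
    rw [← hnode, eval_prod]; exact Finset.prod_eq_zero (Finset.mem_univ k) (by simp)
  have hdiag := christoffel_darboux_kernel_diag hν hw htN hq0 hq1 hrec horth (m := t + 1) le_rfl (z k)
  rw [hroot, mul_zero, sub_zero] at hdiag
  have hone := gauss_kernel_on_nodes hν hw htN hq0 hq1 hrec horth hz hmom k k
  rw [if_pos rfl] at hone
  have hh : ∑ l, ν l * ((q t).eval (w l)) ^ 2 ≠ 0 := (sum_mul_eval_sq_pos_of_natDegree_lt hν hw (hmd t).1.ne_zero (by rw [(hmd t).2]; omega)).ne'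
  -- `λ_k K = 1` and `h_t K = q′_{t+1} q_t` at the node
  have hK : ∑ j ∈ Finset.range (t + 1), (q j).eval (z k) * (q j).eval (z k) / ∑ l', ν l' * ((q j).eval (w l')) ^ 2 =
      ∑ j ∈ Finset.range (t + 1), ((q j).eval (z k)) ^ 2 / ∑ l', ν l' * ((q j).eval (w l')) ^ 2 := Finset.sum_congr rfl fun j _ => by rw [sq]
  rw [hK] at hone
  calc μ k * ((derivative (q (t + 1))).eval (z k) * (q t).eval (z k))
      = μ k * ((∑ l, ν l * ((q t).eval (w l)) ^ 2) * ∑ j ∈ Finset.range (t + 1), ((q j).eval (z k)) ^ 2 / ∑ l', ν l' * ((q j).eval (w l')) ^ 2) := by rw [hdiag]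
    _ = (∑ l, ν l * ((q t).eval (w l)) ^ 2) * (μ k * ∑ j ∈ Finset.range (t + 1), ((q j).eval (z k)) ^ 2 / ∑ l', ν l' * ((q j).eval (w l')) ^ 2) := by ring
    _ = ∑ l, ν l * ((q t).eval (w l)) ^ 2 := by rw [hone, mul_one]

/-- **`λ_k · q_{t+1}′(z_k) q_{t+2}(z_k) = −h_{t+1}`** (the second form: at a node `q_{t+2}(z_k) = −b_{t+1} q_t(z_k)` and `h_{t+1} = b_{t+1} h_t`). [Szegő (3.4.8); Chihara I Thm 6.2; this file, §1073] -/
theorem gauss_weight_mul_deriv_mul_succ_eq_neg_norm {N t : ℕ} {ν w : Fin N → ℝ} (hν : ∀ l, 0 < ν l) (hw : Function.Injective w) (htN : t + 2 < N) {q : ℕ → ℝ[X]} {a b : ℕ → ℝ}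
    (hq0 : q 0 = 1) (hq1 : q 1 = Polynomial.X - C (a 0)) (hrec : ∀ n, q (n + 2) = (Polynomial.X - C (a (n + 1))) * q (n + 1) - C (b (n + 1)) * q n)
    (horth : ∀ k, k ≤ t + 2 → ∀ G : ℝ[X], G.natDegree < k → ∑ l, ν l * (q k * G).eval (w l) = 0) {μ z : Fin (t + 1) → ℝ} (hz : StrictMono z)
    (hmom : ∀ p, p ≤ 2 * t + 1 → ∑ k, μ k * z k ^ p = ∑ l, ν l * w l ^ p) (k : Fin (t + 1)) :
    μ k * ((derivative (q (t + 1))).eval (z k) * (q (t + 2)).eval (z k)) = -∑ l, ν l * ((q (t + 1)).eval (w l)) ^ 2 := by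
  have hmd := recurrence_monic_natDegree hq0 hq1 hrec
  have hnode : ∏ j, (Polynomial.X - C (z j)) = q (t + 1) := nodePoly_eq_of_exact hν hw (by omega) hmom (hmd (t + 1)).1 (hmd (t + 1)).2 (horth (t + 1) (by omega))
  have hroot : (q (t + 1)).eval (z k) = 0 := by
    rw [← hnode, eval_prod]; exact Finset.prod_eq_zero (Finset.mem_univ k) (by simp)
  have hval : (q (t + 2)).eval (z k) = -(b (t + 1) * (q t).eval (z k)) := by
    rw [hrec t, eval_sub, eval_mul, eval_mul, eval_C, hroot, mul_zero, zero_sub]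
  have h1 := gauss_weight_mul_deriv_mul_eq_norm hν hw (by omega) hq0 hq1 hrec (fun k hk => horth k (by omega)) hz hmom k
  rw [sum_sq_succ_eq_b_mul_sum_sq hq0 hq1 hrec t (horth (t + 1) (by omega)) (horth (t + 2) le_rfl), ← h1, hval]
  ring

end Summit.Ventures.HSemireg.Wedge.HankelOuter
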